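import Mathlib
import Summits.KontsevichZagierPeriods.KontsevichZagierPeriods.Theorems.InverseLandauTateLiftingDimOneUnitChart
import Summits.KontsevichZagierPeriods.KontsevichZagierPeriods.Theorems.InverseLandauTateLiftingDimOneUnitKernel

/-!
# `TateLifting` (stmt-KontsevichZagierPeriods-9129), line `Sketch` — stub `stub_dimOneAlgUnitChart`

UNIT CHART OF AN INTERVAL PIECE, ALGEBRAIC COEFFICIENTS. A one-dimensional representation
`ρ = [(u,v), p/q]` (`u < v` real algebraic, `p, q ∈ ℝ[x₀]` with real-ALGEBRAIC coefficients,
`q ≠ 0` on the OPEN interval, `p/q ∈ L¹(u,v)` by `ρ.integrableOn`) differs by relations from a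
representation in UNIT FORM `ρ' = [(0,1), P/Q]` with `P, Q ∈ ℝ[x]` having real-algebraic
coefficients and `Q ≠ 0` on the CLOSED interval `[0,1]`.

This is the landed `tateLifting_dimOneUnitChart` (KZ-rational integrands, `ℚ` coefficients) with
the hypothesis `ρ.IsRational` replaced by an explicit algebraic-coefficient reading `(p, q)`.

Proof.
* A real polynomial with real-algebraic coefficients lifts to `K[X]`, `K = ℚ̄ ∩ ℝ =
  algebraicClosure ℚ ℝ` (`DimOne.uk_algCoeff_iff_mem_lifts`, `Polynomial.mem_lifts`), so the
  integrand reads `P₀(x₀)/Q₀(x₀)` on the domain with `P₀, Q₀ ∈ K[X]` (`DimOne.auc_exists_reading`).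
* If `P₀ = 0` take `P = 0`, `Q = 1`. Otherwise `Q₀ ≠ 0`, and integrability of `P₀/Q₀` on `(u,v)`
  forces NO INTEGRABLE POLE at the end points: `ord_a Q₀ ≤ ord_a P₀` for `a = u, v`
  (`KZ.rootMultiplicity_le_of_integrableOn`, transported along `K ↪ ℝ` by
  `Polynomial.eq_rootMultiplicity_map`); the common factor `(X − u)^{ord_u Q₀} (X − v)^{ord_v Q₀}`
  cancels (`DimOne.uc_cancel`), leaving `P, Q ∈ K[X]` with `Q ≠ 0` on `[u,v]` and
  `P₀/Q₀ = P/Q` point-wise on `(u,v)` (`DimOne.auc_exists_cancelled`).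
* The affine chart `s = (t − u)/(v − u)` is ONE change of variables (rule 2): `DimOne.uc_chart`.

References: J. Viu-Sos, *A semi-canonical reduction for periods of Kontsevich–Zagier*, Int. J.
Number Theory 17 (2021), §2.3 (first paragraph: no pole to separate in dimension one);
M. Kontsevich, D. Zagier, *Periods* (2001), §1.2, rules (1), (2).
-/

noncomputable section

open MeasureTheory Set Polynomial
open Literature.NumberTheory.Transcendental

namespace Summit.KontsevichZagierPeriods.InverseLandau

namespace DimOne

/-! ### Reading an algebraic-coefficient integrand of dimension one over `K = ℚ̄ ∩ ℝ`

Below `K` is `algebraicClosure ℚ ℝ`, the intermediate field of real algebraic numbers, and the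
real polynomial attached to `f ∈ K[X]` is `f.map (algebraMap K ℝ)`. -/

/-- A real polynomial with real-algebraic coefficients is the real polynomial attached to a
polynomial over `K`. [folklore] -/
theorem auc_exists_map_eq (p : ℝ[X]) (hp : ∀ n, IsAlgebraic ℚ (p.coeff n)) :
    ∃ P : (algebraicClosure ℚ ℝ)[X], P.map (algebraMap _ ℝ) = p :=
  (Polynomial.mem_lifts p).1 ((uk_algCoeff_iff_mem_lifts p).1 hp)

/-- **Reading over `K`.** An integrand of dimension one which is `p(x₀)/q(x₀)` on the domain,
`p, q ∈ ℝ[X]` with real-algebraic coefficients and `q(x₀) ≠ 0` on the domain, is `P(x₀)/Q(x₀)` on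
the domain for polynomials `P, Q` over `K`, `Q(x₀) ≠ 0` on the domain. [folklore] -/
theorem auc_exists_reading (ρ : KZ.IntegralRep 1) (p q : ℝ[X])
    (hp : ∀ i, IsAlgebraic ℚ (p.coeff i)) (hq : ∀ i, IsAlgebraic ℚ (q.coeff i))
    (hq0 : ∀ x ∈ ρ.domain, q.eval (x 0) ≠ 0)
    (hpq : EqOn ρ.integrand (fun x => p.eval (x 0) / q.eval (x 0)) ρ.domain) :
    ∃ P Q : (algebraicClosure ℚ ℝ)[X], (∀ x ∈ ρ.domain, (Q.map (algebraMap _ ℝ)).eval (x 0) ≠ 0) ∧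
      EqOn ρ.integrand
        (fun x => (P.map (algebraMap _ ℝ)).eval (x 0) / (Q.map (algebraMap _ ℝ)).eval (x 0))
        ρ.domain := by
  obtain ⟨P, hP⟩ := auc_exists_map_eq p hp
  obtain ⟨Q, hQ⟩ := auc_exists_map_eq q hq
  refine ⟨P, Q, ?_, ?_⟩
  · rw [hQ]
    exact hq0
  · rw [hP, hQ]
    exact hpq

/-- **No integrable pole at the end points.** For `ρ = [(u,v), P₀/Q₀]` (as functions of `x₀`;
`P₀, Q₀ ∈ K[X]`, `Q₀ ≠ 0` on the OPEN interval) there are `P, Q ∈ K[X]` with `Q ≠ 0` on the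
CLOSED interval `[u,v]` and `ρ.integrand = P(x₀)/Q(x₀)` on the domain: if `P₀ = 0` take `P = 0`,
`Q = 1`; otherwise integrability of `P₀/Q₀` on `(u,v)` gives `ord_a Q₀ ≤ ord_a P₀` at `a = u, v`
(`KZ.rootMultiplicity_le_of_integrableOn`), and the common factor
`(X − u)^{ord_u Q₀} (X − v)^{ord_v Q₀}` cancels point-wise on the open interval (`uc_cancel`).
[cite: ViuSos2021, §2.3] -/
theorem auc_exists_cancelled {u v : ℝ} (hu : IsAlgebraic ℚ u) (hv : IsAlgebraic ℚ v)
    (huv : u < v) (ρ : KZ.IntegralRep 1) (hdom : ρ.domain = {x | x 0 ∈ Ioo u v})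
    (P₀ Q₀ : (algebraicClosure ℚ ℝ)[X])
    (hQ₀ : ∀ x ∈ ρ.domain, (Q₀.map (algebraMap _ ℝ)).eval (x 0) ≠ 0)
    (hf : EqOn ρ.integrand
      (fun x => (P₀.map (algebraMap _ ℝ)).eval (x 0) / (Q₀.map (algebraMap _ ℝ)).eval (x 0))
      ρ.domain) :
    ∃ P Q : (algebraicClosure ℚ ℝ)[X], (∀ t ∈ Icc u v, (Q.map (algebraMap _ ℝ)).eval t ≠ 0) ∧
      EqOn ρ.integrand
        (fun x => (P.map (algebraMap _ ℝ)).eval (x 0) / (Q.map (algebraMap _ ℝ)).eval (x 0))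
        ρ.domain := by
  -- adapted from Theorems/InverseLandauTateLiftingDimOneUnitChart.lean (`uc_exists_cancelled`),
  -- starting from a `K`-reading instead of `uc_exists_reading`
  have hinj : Function.Injective (algebraMap (algebraicClosure ℚ ℝ) ℝ) :=
    (algebraMap (algebraicClosure ℚ ℝ) ℝ).injective
  -- `Q₀ ≠ 0` on the open interval, read on the line
  have hQt : ∀ t ∈ Ioo u v, (Q₀.map (algebraMap _ ℝ)).eval t ≠ 0 := fun t ht =>
    hQ₀ (fun _ => t) (by rw [hdom]; exact ht)
  by_cases hP : P₀ = 0
  · -- vanishing integrand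
    refine ⟨0, 1, fun t _ => ?_, fun x hx => (hf hx).trans ?_⟩
    · rw [Polynomial.map_one, eval_one]
      exact one_ne_zero
    · simp [hP]
  -- `Q₀ ≠ 0` (the domain is non-empty) and `P₀ ≠ 0`
  have hQ : Q₀ ≠ 0 := by
    rintro rfl
    refine hQt ((u + v) / 2) ⟨by linarith, by linarith⟩ ?_
    rw [Polynomial.map_zero, eval_zero]
  have hPR : P₀.map (algebraMap _ ℝ) ≠ 0 := (Polynomial.map_ne_zero_iff hinj).2 hP
  have hQR : Q₀.map (algebraMap _ ℝ) ≠ 0 := (Polynomial.map_ne_zero_iff hinj).2 hQ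
  -- integrability on the line forces `ord_a Q₀ ≤ ord_a P₀` on `[u, v]`
  have hint : IntegrableOn
      (fun t => (P₀.map (algebraMap _ ℝ)).eval t / (Q₀.map (algebraMap _ ℝ)).eval t) (Ioo u v) :=
    uc_integrableOn_Ioo (by rw [← hdom]; exact ρ.integrableOn)
      fun x hx => hf (by rw [hdom]; exact hx)
  have hle : ∀ a : algebraicClosure ℚ ℝ, (a : ℝ) ∈ Icc u v →
      Q₀.rootMultiplicity a ≤ P₀.rootMultiplicity a := fun a ha => by
    rw [eq_rootMultiplicity_map hinj a, eq_rootMultiplicity_map hinj a]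
    exact KZ.rootMultiplicity_le_of_integrableOn hPR hQR huv ha hint
  -- cancel the end-point factors
  have huK : u ∈ algebraicClosure ℚ ℝ := mem_algebraicClosure_iff.2 hu
  have hvK : v ∈ algebraicClosure ℚ ℝ := mem_algebraicClosure_iff.2 hv
  obtain ⟨D, P₁, Q₁, hP₁, hQ₁, hQ₁u, hQ₁v⟩ :=
    uc_cancel hQ (u := ⟨u, huK⟩) (v := ⟨v, hvK⟩) (fun h => huv.ne (congrArg Subtype.val h))
      rfl rfl
      ((pow_dvd_pow _ (hle _ (left_mem_Icc.2 huv.le))).trans (pow_rootMultiplicity_dvd P₀ _))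
      ((pow_dvd_pow _ (hle _ (right_mem_Icc.2 huv.le))).trans (pow_rootMultiplicity_dvd P₀ _))
  refine ⟨P₁, Q₁, fun t ht => ?_, fun x hx => (hf hx).trans ?_⟩
  · rcases eq_endpoints_or_mem_Ioo_of_mem_Icc ht with h | h | ht'
    · rw [h]
      change (Q₁.map (algebraMap _ ℝ)).eval ((⟨u, huK⟩ : algebraicClosure ℚ ℝ) : ℝ) ≠ 0
      rw [uc_eval_map_coe, map_ne_zero_iff _ hinj]
      exact hQ₁u
    · rw [h]
      change (Q₁.map (algebraMap _ ℝ)).eval ((⟨v, hvK⟩ : algebraicClosure ℚ ℝ) : ℝ) ≠ 0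
      rw [uc_eval_map_coe, map_ne_zero_iff _ hinj]
      exact hQ₁v
    · have h := hQt t ht'
      rw [hQ₁, Polynomial.map_mul, eval_mul] at h
      exact right_ne_zero_of_mul h
  · have hx' : x 0 ∈ Ioo u v := by
      rw [hdom] at hx
      exact hx
    have hD : (D.map (algebraMap _ ℝ)).eval (x 0) ≠ 0 := by
      have h := hQt _ hx'
      rw [hQ₁, Polynomial.map_mul, eval_mul] at h
      exact left_ne_zero_of_mul h
    beta_reduce
    rw [hP₁, hQ₁, Polynomial.map_mul, Polynomial.map_mul, eval_mul, eval_mul,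
      mul_div_mul_left _ _ hD]

end DimOne

/-- **UNIT CHART OF AN INTERVAL PIECE, ALGEBRAIC COEFFICIENTS** (stub `stub_dimOneAlgUnitChart` of
the line `Sketch` of `TateLifting`, i.e. the body of `DimOneAlgUnitChart`). A representation
`ρ = [(u,v), p/q]` (`u < v` real algebraic, `p, q ∈ ℝ[x₀]` with real-algebraic coefficients,
`q ≠ 0` on `(u,v)`, `p/q ∈ L¹(u,v)`) differs by relations from a representation
`ρ' = [(0,1), P/Q]` with `P, Q ∈ ℝ[x]` having real-algebraic coefficients and `Q ≠ 0` on the CLOSED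
interval `[0,1]`: `p, q` lift to `K[X]`, `K = ℚ̄ ∩ ℝ` (`DimOne.uk_algCoeff_iff_mem_lifts`);
integrability forces `ord_a q ≤ ord_a p` at `a = u, v` (`KZ.rootMultiplicity_le_of_integrableOn`),
so the common factors `(x−u)^i (x−v)^j` cancel point-wise on the open interval, and the affine
chart `x = u + (v−u)s` is one change of variables (rule 2, `DimOne.uc_chart`).
[cite: ViuSos2021, §2.3] -/
theorem tateLifting_dimOneAlgUnitChart :
    ∀ (u v : ℝ), IsAlgebraic ℚ u → IsAlgebraic ℚ v → u < v →
      ∀ (ρ : KZ.IntegralRep 1) (p q : Polynomial ℝ), ρ.domain = {x | x 0 ∈ Set.Ioo u v} →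
        (∀ i, IsAlgebraic ℚ (p.coeff i)) → (∀ i, IsAlgebraic ℚ (q.coeff i)) →
        (∀ x ∈ ρ.domain, q.eval (x 0) ≠ 0) →
        Set.EqOn ρ.integrand (fun x => p.eval (x 0) / q.eval (x 0)) ρ.domain →
        ∃ (P Q : Polynomial ℝ) (ρ' : KZ.IntegralRep 1),
          (∀ n, IsAlgebraic ℚ (P.coeff n)) ∧ (∀ n, IsAlgebraic ℚ (Q.coeff n)) ∧
          (∀ t ∈ Set.Icc (0 : ℝ) 1, Q.eval t ≠ 0) ∧
          ρ'.domain = {x | x 0 ∈ Set.Ioo (0 : ℝ) 1} ∧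
          Set.EqOn ρ'.integrand (fun x => P.eval (x 0) / Q.eval (x 0)) ρ'.domain ∧
          KZ.of ρ - KZ.of ρ' ∈ KZ.relations := by
  intro u v hu hv huv ρ p q hdom hp hq hq0 hpq
  obtain ⟨P₀, Q₀, hQ₀, hf⟩ := DimOne.auc_exists_reading ρ p q hp hq hq0 hpq
  obtain ⟨P, Q, hQ, hPQ⟩ := DimOne.auc_exists_cancelled hu hv huv ρ hdom P₀ Q₀ hQ₀ hf
  exact DimOne.uc_chart hu hv huv ρ hdom P Q hQ hPQ

end Summit.KontsevichZagierPeriods.InverseLandau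

end
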